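import Literature.MathematicalPhysics.QuantumFieldTheory.Balaban1983to89.Node00.Record11Beta
import Summits.QuantumFields.YangMills.Theorems.BalabanUVNodesN28ZeroChart
import Summits.QuantumFields.YangMills.Theorems.BalabanUVNodesN26AtBetaOfRecord11

/-!
# BalabanUVNodes ∕ N28 — binder B6 «`0 < β̄`, `0 < γc`» AT NODE 00's STAGE-11 RECORD `IsRecordOfRecord₁₁C`, over the β OF RECORD
# BY NAME (`Node00.betaOfRecord₁₁`, seat node00-def-B's `Node00/Record11Beta.lean`): the bridge twin of `BalabanUVNodesN28AtRecord9`

HONEST FRAMING.  Count-neutral kernel bookkeeping BY NAME for a VACATED binder (N28 «closes with B3», N25 = NODE O); NOT a node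
discharge, not an estimate; nothing of Bałaban's β asserted or refuted; every `∀`-form over `IsRecordOfRecord₁₁C` is NOT-A-DISCHARGE
(inhabitation at Stage 11 is the route's item K0 `Record11Inhabited`, not claimed).  One finite four-torus programme at fixed `ε`;
nothing continuum ∕ ℝ⁴ ∕ OS ∕ mass-gap ∕ Clay.

WHAT IS NEW AT STAGE 11 FOR N28 (RIDER OF RECORD №6, β-VERSION — MET).  At Stage 9 N28's two faces were read over
`betaOfRecord₉ = betaOfRecord₈ ∘ toStage8Params`, an `rnDeriv`-REPRESENTATIVE β over which no β-side binder was bookable.  The Stage-11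
record carries the repair: `(datumOfRecord₁₁ θ h).βfun = betaOfRecord₁₁ θ = betaOfMerged (betaMergedOfRecord₁₁ θ) (beta0OfRecord₁₁ θ) θ.γ`
(`rfl`, def-B) — the merged β (1.22) over the CONTINUOUS-VERSION transport `TcOfRecord` and the flow-blind `chiFixed7`, with the
β-version proviso certified by the record (`Provisos₁₁.hasContTransportAlong`).  So every face below is def-B's Stage-11 `iff` or the
`N28AtBetaOfRecord` generic at `(βm, β0, γ) := (betaMergedOfRecord₁₁ θ, beta0OfRecord₁₁ θ, θ.γ)`; `0 < θ.γ` (§1) is the load-bearing face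
(`N28AtBetaOfRecord.betaOfMerged_of_nonpos`: at `γ ≤ 0` the β of record collapses to the constant family `β⁰`).
* §1 `0 < θ.γ` and B6's necessary-condition shadow `θ.ρ8 ≠ 0` (`2 ≤ N`) at admissible Stage-11 parameters.
* §2 N28's `γc`-HALF: (B4) with `0 < γc` for the Stage-11 datum from joint continuity of the merged β of record on the binding world's
  OWN box, witness `γc := w.γ` (window and record forms; converse) — hypotheses displayed ((D4)-chain ∕ NODE O supplies them:
  dag-n26-c's `BalabanUVNodesN26AtBetaOfRecord11`).
* §3 N28's `β̄`-HALF: the one-loop numbers every NODE-O road reads at a Stage-11 datum ARE `beta0OfRecord₁₁ θ` (dag-n26-c's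
  `β0_eq_beta0OfRecord₁₁` at the datum); control rule v0.29's shape «named limit existence + uniform AF bound on a box ∋ `θ.v₀` ⇒
  `0 < b ≤ β⁰_k`»; the literal (B3) is rigid (`β⁰_k = β̄`); the packaged literal pair `BetaPertHyp` at the datum ↔ at the merged β; record form.
* §4 THE `N = 1` GUARD AT STAGE 11: 𝔰𝔲(1) = 0, so at every admissible `θ : Stage11Params F 1` the β of record IS `zeroHBeta`
  (chart clause of ₉-admissibility + `betaMerged_zeroChart`) — N28's `γc`-half HOLDS and `0 < β̄` FAILS at every Stage-11 record of
  `SU(1)`: the clause `2 ≤ N` is load-bearing for any β-side `∃`-claim (chair R448 (1)).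
Sources: T. Bałaban, CMP **109** (1987) 249–301 [Balaban1987RG1] (1.20)–(1.22) p. 264, (2.12)–(2.14) p. 268, Thm 2 (0.31) p. 259;
CMP **122** (1989) 355–392 [Balaban1989LargeFieldII] Thm 1 p. 355; B. C. Hall (2015) Example 7.3.  0 `def`, 0 `sorry`, standard axioms.
-/

namespace Summit.QuantumFields.YangMills.BalabanUVNodes.N28AtRecord11

open Literature.MathematicalPhysics.QuantumFieldTheory.Balaban1983to89
open Literature.MathematicalPhysics.QuantumFieldTheory.Balaban1983to89.FlowStep
open Literature.MathematicalPhysics.QuantumFieldTheory.Balaban1983to89.Node00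
open Literature.MathematicalPhysics.QuantumFieldTheory.Balaban1983to89.T4Continuum (T4Family BetaPertHyp FiniteEpsData)
open Literature.MathematicalPhysics.QuantumFieldTheory.Balaban1983to89.T4FiniteEpsInhabited (zeroHBeta)
open Literature.MathematicalPhysics.QuantumFieldTheory.Balaban1983to89.DagBinding (WorldP)
open Literature.MathematicalPhysics.QuantumFieldTheory.Balaban1983to89.BetaPertRigid (RemainderVanishes)
open Literature.MathematicalPhysics.QuantumFieldTheory.Balaban1983to89.Node00.Record8Inhabited (betaMerged_zeroChart beta0OfMerged_zeroHBeta
  betaOfMerged_zeroHBeta)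
open Summit.QuantumFields.YangMills.BalabanUVNodes.N28AtBetaOfRecord
open Summit.QuantumFields.YangMills.BalabanUVNodes.N28ZeroChart
open Summit.QuantumFields.YangMills.Theorems.BalabanUVNodesN26AtBetaOfRecord11 (β0_eq_beta0OfRecord₁₁ oneLoopSplit_eq_oneLoopSplitOfRecord₁₁)
open scoped Matrix.Norms.L2Operator

variable {F : T4Family} {N : ℕ} [NeZero N]

/-! ## §1 What Stage-11 admissibility gives N28, by name -/

/-- **THE LOAD-BEARING FACE `0 < θ.γ`** at admissible Stage-11 parameters (₉-admissibility's `gamma_pos`): the box of record is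
non-empty, so the β of record is NOT the constant family of its one-loop numbers (`betaOfMerged_of_nonpos` cannot fire).
[cite: Balaban1987RG1, (1.22) p.264 («defined on the interval [0, γ]»)] -/
theorem gamma_pos_of_admissible₁₁ {θ : Stage11Params F N} (hθ : θ.Admissible) : 0 < θ.γ := hθ.toStage9.gamma_pos

/-- **B6's NECESSARY-CONDITION SHADOW AT STAGE 11**: at admissible Stage-11 parameters with `2 ≤ N` the β-layer's chart `θ.ρ8` is not
the zero map (₉-admissibility's chart clause of record with `0 < θ.cβ`; `IsChartOfRecord.rho8_ne_zero`). [cite: Balaban1987RG1, (1.20)–(1.21) p.264] -/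
theorem rho8_ne_zero_of_admissible₁₁ {θ : Stage11Params F N} (hθ : θ.Admissible) (hN : 2 ≤ N) :
    (letI := θ.instVβ₁; letI := θ.instVβ₂; θ.ρ8) ≠ 0 :=
  hθ.toStage9.chart.2.rho8_ne_zero hθ.toStage9.chart.1 hN

/-! ## §2 N28's `γc`-half at a Stage-11 record -/

/-- **(B4) WITH N28's SIDE CONDITION AT A STAGE-11 DATUM, from the world's own box.**  For Stage-11 parameters `θ` (with provisos) and
a world obeying the record's γ-clause `0 < w.γ ≤ θ.γ`: joint continuity of the MERGED β of record on the binding world's box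
`]0, w.γ]^{k+1}` gives (B4) for the Stage-11 datum with `γc := w.γ` (def-B's `betaContH_betaOfRecord₁₁_iff`).  Hypothesis displayed,
not asserted. [cite: Balaban1989LargeFieldII, Thm 1 p.355; Balaban1987RG1, §1 p.264] -/
theorem b4_with_sideCondition_record₁₁_window (θ : Stage11Params F N) (hP : θ.Provisos₁₁) (w : WorldP) (hw : 0 < w.γ ∧ w.γ ≤ θ.γ)
    (hC : BetaContH w.γ (betaMergedOfRecord₁₁ F N θ)) : 0 < w.γ ∧ BetaContH w.γ (datumOfRecord₁₁ F N θ hP).βfun :=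
  ⟨hw.1, (betaContH_betaOfRecord₁₁_iff θ hw.2).mpr hC⟩

/-- … and conversely: (B4) for the Stage-11 datum on a window `w.γ ≤ θ.γ` GIVES the merged-β continuity on that window.
[cite: Balaban1987RG1, §1 p.264] -/
theorem betaContH_merged₁₁_of_b4_window (θ : Stage11Params F N) (hP : θ.Provisos₁₁) (w : WorldP) (hle : w.γ ≤ θ.γ)
    (hC : BetaContH w.γ (datumOfRecord₁₁ F N θ hP).βfun) : BetaContH w.γ (betaMergedOfRecord₁₁ F N θ) :=
  (betaContH_betaOfRecord₁₁_iff θ hle).mp hC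

/-- **(B4) WITH `0 < γc` AT A STAGE-11 RECORD, window form.**  If at every admissible presentation `(θ, hP)` of `D` whose record box
contains the world's window the merged β of record is jointly continuous on the WORLD's box `]0, w.γ]^{k+1}`, then `(D, w)` satisfies
binder (B4) with N28's side condition — witness `γc := w.γ`. [cite: Balaban1989LargeFieldII, Thm 1 p.355] -/
theorem exists_b4_of_isRecordOfRecord₁₁C_window {D : FiniteEpsData F (SU N)} {w : WorldP} (h : IsRecordOfRecord₁₁C F N D w)
    (hC : ∀ (θ : Stage11Params F N) (hP : θ.Provisos₁₁), θ.Admissible → D = datumOfRecord₁₁ F N θ hP → w.γ ≤ θ.γ →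
      BetaContH w.γ (betaMergedOfRecord₁₁ F N θ)) :
    ∃ γc : ℝ, 0 < γc ∧ BetaContH γc D.βfun := by
  obtain ⟨θ, hP, hθ, hD, -, hw, -, -⟩ := h
  subst hD
  exact ⟨w.γ, b4_with_sideCondition_record₁₁_window θ hP w hw (hC θ hP hθ rfl hw.2)⟩

/-! ## §3 N28's `β̄`-half at a Stage-11 record -/

/-- **THE ONE-LOOP NUMBERS A NODE-O ROAD READS AT A STAGE-11 DATUM ARE `beta0OfRecord₁₁ θ` BY NAME**: for every one-loop split `S` of
the Stage-11 datum's β-functions, `S.β0 = beta0OfRecord₁₁ θ` (the split is never a choice — dag-n26-c's `β0_eq_beta0OfRecord₁₁`, i.e.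
`oneLoopSplit_unique`, read at the datum whose β IS `betaOfRecord₁₁ θ`). [cite: Balaban1987RG1, (2.12)–(2.14) p.268] -/
theorem oneLoopSplit_β0_record₁₁ (θ : Stage11Params F N) (hP : θ.Provisos₁₁)
    (S : B12Beta.OneLoopSplit (datumOfRecord₁₁ F N θ hP).βfun) : S.β0 = beta0OfRecord₁₁ F N θ :=
  β0_eq_beta0OfRecord₁₁ F N θ S

/-- **N28's `β̄` BECOMES (AF-0) OF THE ONE-LOOP NUMBERS OF RECORD — control rule v0.29's shape at Stage 11.**  A uniform
asymptotic-freedom bound `0 < b ≤ D.βfun` for the Stage-11 datum on a box `]0,γ']^{k+1}` inside the record box (`γ' ≤ θ.γ`) whose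
interior contains the reference histories `θ.v₀`, together with the NAMED existence of the one-sided limits
`Beta0LimitExists (betaMergedOfRecord₁₁ θ) θ.v₀`, gives `0 < b ≤ beta0OfRecord₁₁ θ k` for EVERY `k`.  Hypotheses, not facts
([Balaban1989LargeFieldII] p. 355 «has not been published yet»); by §4 `hlo` is UNSATISFIABLE at `N = 1`. [cite: Balaban1989LargeFieldII, Thm 1 p.355; Balaban1987RG1, Thm 2 (0.31) p.259] -/
theorem beta0_record₁₁_pos_of_betaLowerH (θ : Stage11Params F N) (hP : θ.Provisos₁₁)
    (hlim : Beta0LimitExists (betaMergedOfRecord₁₁ F N θ) θ.v₀) {b γ' : ℝ} (hγ' : 0 < γ') (hγ : γ' ≤ θ.γ) (hb : 0 < b)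
    (hv₀ : ∀ k (i : Fin (k + 1)), i ≠ Fin.last k → 0 < θ.v₀ k i ∧ θ.v₀ k i ≤ γ')
    (hlo : BetaLowerH b γ' (datumOfRecord₁₁ F N θ hP).βfun) (k : ℕ) :
    0 < beta0OfRecord₁₁ F N θ k ∧ b ≤ beta0OfRecord₁₁ F N θ k :=
  have hlo' := (betaLowerH_betaOfRecord₁₁_iff θ hγ).mp hlo
  ⟨beta0OfMerged_pos_of_betaLowerH hlim hγ' hb hv₀ hlo' k, le_beta0OfMerged_of_betaLowerH hlim hγ' hv₀ hlo' k⟩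

/-- **THE LITERAL (B3) AT A STAGE-11 DATUM IS RIGID.**  If the remainder of a (hence THE) one-loop split of the Stage-11 datum's β
vanishes along the diagonal as `g → 0⁺` and the LITERAL binder (B3) `BetaPertH D.βfun β̄` holds, then every one-loop number of record
equals `β̄` — which is why the literal (B3) is superseded by `DagBinding.EndpointExistence` and N28 is VACATED with it.
[cite: Balaban1989LargeFieldII, Thm 1 p.355; Balaban1987RG1, (2.12)–(2.14) p.268] -/
theorem beta0_record₁₁_eq_betabar_of_literalB3 (θ : Stage11Params F N) (hP : θ.Provisos₁₁)
    (S : B12Beta.OneLoopSplit (datumOfRecord₁₁ F N θ hP).βfun) (hrem : RemainderVanishes S) {βbar : ℝ}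
    (hB3 : BetaPertH (datumOfRecord₁₁ F N θ hP).βfun βbar) (k : ℕ) : beta0OfRecord₁₁ F N θ k = βbar := by
  have hS : S = oneLoopSplitOfRecord₁₁ F N θ := oneLoopSplit_eq_oneLoopSplitOfRecord₁₁ F N θ S
  subst hS
  exact beta0_eq_betabar_of_literalB3 hrem hB3 k

/-- **N28's LITERAL PAIR AT A STAGE-11 DATUM.**  At admissible Stage-11 parameters the packaged literal β-binder of the UV headline,
`T4Continuum.BetaPertHyp` (= (B3) with `0 < β̄` ∧ (B4) with `0 < γc`), holds for the Stage-11 datum's β-functions iff it holds for the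
merged β of record (`betaPertHyp_betaOfMerged_iff` at `0 < θ.γ`). [cite: Balaban1989LargeFieldII, Thm 1 p.355] -/
theorem betaPertHyp_record₁₁_iff (θ : Stage11Params F N) (hP : θ.Provisos₁₁) (hθ : θ.Admissible) :
    BetaPertHyp (datumOfRecord₁₁ F N θ hP).βfun ↔ BetaPertHyp (betaMergedOfRecord₁₁ F N θ) :=
  betaPertHyp_betaOfMerged_iff (gamma_pos_of_admissible₁₁ hθ)

/-- **N28 AT A STAGE-11 RECORD, packaged.**  At a Stage-11 record `(D, w)`: the window `w.γ` is positive; and IF the merged β of record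
of every admissible presentation (with its provisos) satisfies the literal pair, so does `D.βfun` — N28's `0 < β̄`, `0 < γc` carried
inside `BetaPertHyp`.  All hypotheses displayed; nothing of Bałaban's β asserted. [cite: Balaban1989LargeFieldII, Thm 1 p.355] -/
theorem betaPertHyp_of_isRecordOfRecord₁₁C {D : FiniteEpsData F (SU N)} {w : WorldP} (h : IsRecordOfRecord₁₁C F N D w)
    (hB : ∀ (θ : Stage11Params F N) (hP : θ.Provisos₁₁), θ.Admissible → D = datumOfRecord₁₁ F N θ hP →
      BetaPertHyp (betaMergedOfRecord₁₁ F N θ)) :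
    0 < w.γ ∧ BetaPertHyp D.βfun := by
  obtain ⟨θ, hP, hθ, hD, -, hw, -, -⟩ := h
  refine ⟨hw.1, ?_⟩
  rw [hD]
  exact (betaPertHyp_record₁₁_iff θ hP hθ).mpr (hB θ hP hθ hD)

/-! ## §4 The `N = 1` guard at Stage 11: at every admissible parameter of `SU(1)` the β of record vanishes genuinely -/

section One

variable {F : T4Family}

/-- **At `N = 1` the Stage-11 β of record is the zero family at every admissible parameter**: ₉-admissibility carries a chart of
record, at `N = 1` that chart is the zero map (𝔰𝔲(1) = 0, `IsChartOfRecord.rho8_eq_zero_of_one`), and the merged β of ANY term family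
at the zero chart vanishes (`betaMerged_zeroChart`), whence so do its one-loop numbers and the split-compatible β.
[cite: Hall2015, Example 7.3; Balaban1987RG1, (1.20)–(1.22) p.264 (bookkeeping at N = 1)] -/
theorem betaOfRecord₁₁_eq_zeroHBeta_of_one (θ : Stage11Params F 1) (hθ : θ.Admissible) : betaOfRecord₁₁ F 1 θ = zeroHBeta := by
  have hm : betaMergedOfRecord₁₁ F 1 θ = zeroHBeta := by
    letI := θ.instVβ₁; letI := θ.instVβ₂; letI := θ.instιβ
    show betaMerged F _ θ.ρ8 θ.bV = zeroHBeta
    rw [hθ.toStage9.chart.2.rho8_eq_zero_of_one]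
    exact betaMerged_zeroChart F _ θ.bV
  rw [betaOfRecord₁₁_eq_betaOfMerged, beta0OfRecord₁₁, hm, beta0OfMerged_zeroHBeta, betaOfMerged_zeroHBeta]

/-- **At `N = 1` a Stage-11 record's β-functions are the zero family.** [cite: Hall2015, Example 7.3; Balaban1987RG1, (1.20)–(1.22) p.264 (bookkeeping at N = 1)] -/
theorem βfun_eq_zeroHBeta_of_isRecordOfRecord₁₁C_one {D : FiniteEpsData F (SU 1)} {w : WorldP} (h : IsRecordOfRecord₁₁C F 1 D w) :
    D.βfun = zeroHBeta := by
  obtain ⟨θ, hP, hθ, rfl, -⟩ := h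
  exact betaOfRecord₁₁_eq_zeroHBeta_of_one θ hθ

/-- **N28's B6 CENSUS AT EVERY STAGE-11 RECORD OF `SU(1)`**: the `γc`-half with (B4) HOLDS (every box; `γc := 1` displayed), every
one-loop number of every split is `0`, and the packaged literal pair `BetaPertHyp D.βfun` — N28's `0 < β̄` — FAILS.  Genuine, not junk:
the clause `2 ≤ N` is load-bearing for any β-side `∃`-claim over `IsRecordOfRecord₁₁C`. [cite: Balaban1989LargeFieldII, Thm 1 p.355; Balaban1987RG1, Thm 2 (0.31) p.259 and (2.12)–(2.14) p.268] -/
theorem b6Census_of_isRecordOfRecord₁₁C_one {D : FiniteEpsData F (SU 1)} {w : WorldP} (h : IsRecordOfRecord₁₁C F 1 D w) :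
    (∃ γc : ℝ, 0 < γc ∧ BetaContH γc D.βfun) ∧ (∀ S : B12Beta.OneLoopSplit D.βfun, ∀ k, S.β0 k = 0) ∧ ¬ BetaPertHyp D.βfun := by
  rw [βfun_eq_zeroHBeta_of_isRecordOfRecord₁₁C_one h]
  exact ⟨⟨1, one_pos, betaContH_zeroHBeta 1⟩, oneLoopSplit_β0_zeroHBeta, not_betaPertHyp_zeroHBeta⟩

end One

end Summit.QuantumFields.YangMills.BalabanUVNodes.N28AtRecord11
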